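import Summits.MatrixMultiplication.MatrixMultiplication.Theorems.LittleCwFarEdgeBoundData
import Summits.MatrixMultiplication.MatrixMultiplication.Theorems.FarEdgeDescentLogRate

/-!
# Route `FarEdgeDescent` — little-CW far-edge bound, chain file 2/3: LAYERS B and C (route-free helper)

**B1** a large free diagonal of the 3-letter joint type of `cw_q^{⊗N}` in the far-rectangular weighting
(`exists_free_diagonal_jointType_card`), **B2** its marginal entropies `= h(1/(k+2))` with penalty `Γ = 0` (product form;
the three-point entropy lemmas `shannon₃`, `log_two_mul_shannonEntropy_vec3`, `shannon₃_two` are the LANDED ones of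
`Theorems.FarEdgeDescentLogRate`, imported, not restated — gate dedup.landed), **C** the analytic threshold with a general
`R^N` on the left (the landed `FarEdgeDescentLogRateLayers.cwFullThreshold` is its `R = q+2` instance; the loss estimate is
kept LOCAL to the proof, no top-level restatement of the landed private `loss_le_exp`).  Chain file 2 of 3, imports chain
file 1 (`LittleCwFarEdgeBoundData`) and landed Theorems modules only — no direct `Theses` import.  Written by the decomp-mm
lens-2 planner seat (gen 6).
-/

set_option linter.dupNamespace false

noncomputable section

open Finset
open scoped BigOperators

namespace Summit.MatrixMultiplication.MatrixMultiplication.Theorems.LittleCwFarEdgeBound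

open Literature.Computability.AlgebraicComplexity

open Summit.MatrixMultiplication.MatrixMultiplication.Theorems.FarEdgeDescentLogRate
  (shannon₃ log_two_mul_shannonEntropy_vec3 shannon₃_two)  -- landed, imported

/-! ## Layer B1 — a large free diagonal of the 3-letter joint type -/

section LayerB

/-- **B1.** For `k, M ≥ 1`, `N = (k+2) M` and `P = Q/N` with `Q(1,1,0) = Q(0,1,1) = M`, `Q(1,0,1) = k M`
(`0` elsewhere), there is a family `Δ` of triples of level words, coordinatewise in the little support, each with
exactly `M`, `M`, `k M` positions of pattern `(1,1,0)`, `(0,1,1)`, `(1,0,1)`, forming a free diagonal, with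
`2^{N (min_m H(P_m) − Γ_S(P))} ≤ |Δ| · (N+1)^63 · 192 · exp(4 √(log 6 + N log 27))`
(`exists_free_diagonal_jointType_card` for `S = lcwSupport₃ ⊆ Fin 3³`, `b = 2`). [cite: LeGall2014, Appendix A.3] -/
theorem lcwDiagonalRaw :
    ∀ M k N : ℕ, 1 ≤ M → 1 ≤ k → (k + 2) * M = N →
      ∀ P : Fin 3 × Fin 3 × Fin 3 → ℝ,
      (∀ x, P x = ((if x = (1, 1, 0) then M else if x = (0, 1, 1) then M
          else if x = (1, 0, 1) then k * M else 0 : ℕ) : ℝ) / (N : ℝ)) →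
      ∃ Δ : Finset ((Fin N → Fin 3) × (Fin N → Fin 3) × (Fin N → Fin 3)),
        (∀ δ ∈ Δ, ∀ ρ, labelSeq δ ρ ∈ lcwSupport₃) ∧
        (∀ δ ∈ Δ, letterCount (labelSeq δ) (1, 1, 0) = M ∧ letterCount (labelSeq δ) (0, 1, 1) = M ∧
          letterCount (labelSeq δ) (1, 0, 1) = k * M) ∧
        (∀ δ ∈ Δ, ∀ δ' ∈ Δ, ∀ δ'' ∈ Δ, (∀ ρ, (δ.1 ρ, δ'.2.1 ρ, δ''.2.2 ρ) ∈ lcwSupport₃) →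
          δ = δ' ∧ δ' = δ'') ∧
        (2 : ℝ) ^ ((N : ℝ) *
            (min (shannonEntropy (marginalDist₁ P))
              (min (shannonEntropy (marginalDist₂ P)) (shannonEntropy (marginalDist₃ P))) -
              maxEntropyPenalty lcwSupport₃ P)) ≤
          (Δ.card : ℝ) * ((N : ℝ) + 1) ^ 63 * 192 *
            Real.exp (4 * Real.sqrt (Real.log 6 + (N : ℝ) * Real.log 27)) := by
  intro M k N hM hk hNdef P hP
  classical
  -- tightness data (`i + j + l = 2` on the support)
  have hinj : Function.Injective fun (i : Fin 3) (_ : Fin 1) => (i : ℤ) := by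
    intro i i' h
    have h0 := congrFun h 0
    simp only [Nat.cast_inj] at h0
    exact Fin.ext h0
  have hinjγ : Function.Injective fun (l : Fin 3) (_ : Fin 1) => (l : ℤ) - 2 := by
    intro l l' h
    have h0 := congrFun h 0
    simp only [sub_left_inj, Nat.cast_inj] at h0
    exact Fin.ext h0
  have hbd : ∀ (i : Fin 3) (ρ : Fin 1), |((fun (i : Fin 3) (_ : Fin 1) => (i : ℤ)) i ρ)| ≤ (2 : ℕ) := by
    intro i ρ
    have := i.isLt
    simp only [Nat.cast_ofNat, Nat.abs_cast]
    omega
  have htight : ∀ x ∈ lcwSupport₃, ∀ ρ : Fin 1,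
      (fun (i : Fin 3) (_ : Fin 1) => (i : ℤ)) x.1 ρ + (fun (j : Fin 3) (_ : Fin 1) => (j : ℤ)) x.2.1 ρ +
        (fun (l : Fin 3) (_ : Fin 1) => (l : ℤ) - 2) x.2.2 ρ = 0 := by
    intro x hx ρ
    have hs := lcwSupport₃_sum hx
    simp only
    omega
  -- the joint type `Q`, `N = (k+2) M`
  obtain ⟨Q, hQdef⟩ : ∃ Q : Fin 3 × Fin 3 × Fin 3 → ℕ, Q = fun x =>
      if x = (1, 1, 0) then M else if x = (0, 1, 1) then M else if x = (1, 0, 1) then k * M else 0 :=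
    ⟨_, rfl⟩
  have hN : 0 < N := by
    rw [← hNdef]; exact Nat.mul_pos (by omega) (by omega)
  have hQS : ∀ x, x ∉ lcwSupport₃ → Q x = 0 := by
    intro x hx
    rw [mem_lcwSupport₃_iff] at hx
    push Not at hx
    obtain ⟨h1, h2, h3⟩ := hx
    simp [hQdef, h1, h2, h3]
  have hQ : ∑ x, Q x = N := by
    rw [sum_triple_eq, hQdef, ← hNdef]
    simp [Fin.sum_univ_three]
    ring
  have hP' : ∀ x, P x = (Q x : ℝ) / (N : ℝ) := by
    intro x
    rw [hQdef]
    exact hP x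
  obtain ⟨Δ, hΔQ, hfree, hsize⟩ := exists_free_diagonal_jointType_card lcwSupport₃ (r := 1) (b := 2)
    (fun (i : Fin 3) (_ : Fin 1) => (i : ℤ)) (fun (j : Fin 3) (_ : Fin 1) => (j : ℤ))
    (fun (l : Fin 3) (_ : Fin 1) => (l : ℤ) - 2) hinj hinj hinjγ hbd hbd htight hN Q hQS hQ P hP'
  have hQδ : ∀ δ ∈ Δ, letterCount (labelSeq δ) = Q := fun δ hδ => (Finset.mem_filter.1 (hΔQ hδ)).2
  refine ⟨Δ, ?_, ?_, hfree, ?_⟩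
  · intro δ hδ ρ
    by_contra hρ
    have h0 := hQS _ hρ
    rw [← hQδ δ hδ] at h0
    exact (letterCount_pos_of_apply (labelSeq δ) ρ).ne' h0
  · intro δ hδ
    rw [hQδ δ hδ, hQdef]
    simp
  · refine hsize.trans_eq ?_
    have hmax : (max 2 1 : ℕ) = 2 := by decide
    generalize (N : ℝ) = Nr
    simp only [Fintype.card_prod, Fintype.card_fin, hmax]
    norm_num
    simp only [mul_assoc]

/-! ## Layer B2 — marginals, entropies, `Γ = 0` -/

/-- The three marginals of the 3-letter law with real masses `a` (two short patterns) and `b` (long pattern). -/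
theorem marginalDist_lcw {a b : ℝ} {P : Fin 3 × Fin 3 × Fin 3 → ℝ}
    (hP : ∀ x, P x = if x = (1, 1, 0) then a else if x = (0, 1, 1) then a
      else if x = (1, 0, 1) then b else 0) :
    marginalDist₁ P = ![a, b + a, 0] ∧ marginalDist₂ P = ![b, 2 * a, 0] ∧
      marginalDist₃ P = ![a, b + a, 0] := by
  refine ⟨?_, ?_, ?_⟩ <;> funext i <;> fin_cases i <;>
    simp [marginalDist₁, marginalDist₂, marginalDist₃, Fin.sum_univ_three, hP] <;> ring

/-- **B2.** For the 3-letter type `(M, M, kM)/N`, `N = (k+2)M`: `h(1/(k+2)) ≤ log 2 · (min_m H_bits(P_m) − Γ_S(P))`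
(`H_X = H_Z = h(1/(k+2)) ≤ h(2/(k+2)) = H_Y`, and `Γ_S(P) = 0` since `P` has product form on the support). -/
theorem lcwEntropy :
    ∀ M k N : ℕ, 1 ≤ M → 1 ≤ k → (k + 2) * M = N →
      ∀ P : Fin 3 × Fin 3 × Fin 3 → ℝ,
      (∀ x, P x = ((if x = (1, 1, 0) then M else if x = (0, 1, 1) then M
          else if x = (1, 0, 1) then k * M else 0 : ℕ) : ℝ) / (N : ℝ)) →
      Real.binEntropy (1 / ((k : ℝ) + 2)) ≤
        Real.log 2 * (min (shannonEntropy (marginalDist₁ P))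
          (min (shannonEntropy (marginalDist₂ P)) (shannonEntropy (marginalDist₃ P))) -
          maxEntropyPenalty lcwSupport₃ P) := by
  intro M k N hM hk hNdef P hP
  have hM0 : (0 : ℝ) < M := by exact_mod_cast (by omega : 0 < M)
  have hkR : (1 : ℝ) ≤ (k : ℝ) := by exact_mod_cast hk
  have hk2 : (0 : ℝ) < (k : ℝ) + 2 := by linarith
  have hNr : (N : ℝ) = ((k : ℝ) + 2) * M := by rw [← hNdef]; push_cast; ring
  set a : ℝ := 1 / ((k : ℝ) + 2) with ha
  have ha0 : 0 < a := by positivity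
  -- the law with real masses
  have hMne : (M : ℝ) ≠ 0 := hM0.ne'
  have hk2ne : (k : ℝ) + 2 ≠ 0 := hk2.ne'
  have e1 : ((M : ℕ) : ℝ) / (N : ℝ) = a := by
    rw [hNr, ha]; field_simp
  have e2 : ((k * M : ℕ) : ℝ) / (N : ℝ) = (k : ℝ) * a := by
    rw [hNr, ha]; push_cast; field_simp
  have hPr : ∀ x, P x = if x = (1, 1, 0) then a else if x = (0, 1, 1) then a
      else if x = (1, 0, 1) then (k : ℝ) * a else 0 := by
    intro x
    rw [hP x]
    split_ifs
    · exact e1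
    · exact e1
    · exact e2
    · simp
  have hoff : ∀ x, x ∉ lcwSupport₃ → P x = 0 := by
    intro x hx
    rw [mem_lcwSupport₃_iff] at hx
    push Not at hx
    obtain ⟨h1, h2, h3⟩ := hx
    rw [hPr x]
    simp [h1, h2, h3]
  have hnonneg : ∀ x, 0 ≤ P x := by
    intro x
    rw [hP x]
    positivity
  have hsum : ∑ x, P x = 1 := by
    rw [sum_triple_eq]
    simp only [Fin.sum_univ_three, hPr]
    simp
    rw [ha]
    field_simp
    ring
  have hsimp : P ∈ stdSimplex ℝ (Fin 3 × Fin 3 × Fin 3) := ⟨hnonneg, hsum⟩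
  -- `Γ_S(P) = 0`: product form `P(i,j,l) = f i · g j · h l` on the support
  have hpen : maxEntropyPenalty lcwSupport₃ P = 0 := by
    refine maxEntropyPenalty_eq_zero_of_mul lcwSupport₃ hsimp hoff ![a, 1, 1] ![(k : ℝ) * a, 1, 1]
      ![a, 1, 1] ?_ ?_ ?_ ?_
    · intro x hx
      rw [mem_lcwSupport₃_iff] at hx
      rcases hx with rfl | rfl | rfl <;> simp [ha0]
    · have hka : 0 < (k : ℝ) * a := mul_pos (by linarith) ha0
      intro x hx
      rw [mem_lcwSupport₃_iff] at hx
      rcases hx with rfl | rfl | rfl <;> simp [hka]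
    · intro x hx
      rw [mem_lcwSupport₃_iff] at hx
      rcases hx with rfl | rfl | rfl <;> simp [ha0]
    · intro x hx
      rw [mem_lcwSupport₃_iff] at hx
      rcases hx with rfl | rfl | rfl <;> simp [hPr]
  obtain ⟨h₁, h₂, h₃⟩ := marginalDist_lcw hPr
  have hlog : 0 < Real.log 2 := Real.log_pos one_lt_two
  rw [h₁, h₂, h₃, hpen, sub_zero]
  set A := shannonEntropy ![a, (k : ℝ) * a + a, 0] with hA
  set B := shannonEntropy ![(k : ℝ) * a, 2 * a, 0] with hB
  have hmin : min A (min B A) = min B A := by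
    rw [min_comm B A, ← min_assoc, min_self]
  have e1 : (k : ℝ) * a + a = 1 - a := by rw [ha]; field_simp; ring
  have e2 : (k : ℝ) * a = 1 - 2 * a := by rw [ha]; field_simp; ring
  have eA : Real.log 2 * A = Real.binEntropy a := by
    rw [hA, log_two_mul_shannonEntropy_vec3, e1, shannon₃_two]
  have eB : Real.log 2 * B = Real.binEntropy (2 * a) := by
    rw [hB, log_two_mul_shannonEntropy_vec3, e2, ← Real.binEntropy_one_sub (2 * a), ← shannon₃_two]
    unfold shannon₃; ring_nf
  -- `h(a) ≤ h(2a)`: monotone on `[0,1/2]` for `k ≥ 2`, symmetric equality for `k = 1`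
  have hle : Real.binEntropy a ≤ Real.binEntropy (2 * a) := by
    rcases eq_or_lt_of_le hk with h1 | h2
    · have : (k : ℝ) = 1 := by exact_mod_cast h1.symm
      rw [ha, this, show (2 : ℝ) * (1 / (1 + 2)) = 1 - 1 / (1 + 2) by norm_num, Real.binEntropy_one_sub]
    · have hk2' : (2 : ℝ) ≤ (k : ℝ) := by exact_mod_cast h2
      apply Real.binEntropy_strictMonoOn.monotoneOn
      · constructor
        · positivity
        · rw [ha, div_le_iff₀ hk2]; linarith
      · constructor
        · positivity
        · rw [ha, ← div_eq_mul_one_div, div_le_iff₀ hk2]; linarith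
      · linarith
  rw [hmin, mul_min_of_nonneg _ _ hlog.le, eA, eB]
  exact le_min hle le_rfl

end LayerB

/-! ## Layer C — the analytic threshold, with `r^N` on the left -/

section LayerC

/-- **C (analytic threshold).** For `q ≥ 2`, `m ≥ 1`, `N₀ ≥ 2`, reals `R > 0`, `H` and `δ > 0` there is `L ≥ 1` such
that, with `N = L·N₀`, every `V : ℕ` with `exp(N·H) ≤ V · (N+1)^63 · 192 · exp(4 √(log 6 + N log 27))` satisfies
`R^N ≤ V · (q^{L m})^((log R − H)/((m/N₀) log q) + δ)`. [folklore] -/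
theorem lcwThreshold :
    ∀ q m N₀ : ℕ, 2 ≤ q → 1 ≤ m → 2 ≤ N₀ → ∀ R H δ : ℝ, 0 < R → 0 < δ → ∃ L : ℕ, 1 ≤ L ∧ ∀ V : ℕ,
      Real.exp (((L * N₀ : ℕ) : ℝ) * H) ≤
          (V : ℝ) * (((L * N₀ : ℕ) : ℝ) + 1) ^ 63 * 192 *
            Real.exp (4 * Real.sqrt (Real.log 6 + ((L * N₀ : ℕ) : ℝ) * Real.log 27)) →
      R ^ (L * N₀) ≤ (V : ℝ) * ((q ^ (L * m) : ℕ) : ℝ) ^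
          ((Real.log R - H) / ((m : ℝ) / (N₀ : ℝ) * Real.log (q : ℝ)) + δ) := by
  intro q m N₀ hq hm hN₀ R H δ hR hδ
  have lossGen : ∀ {K M κ : ℝ}, 0 ≤ K → 1 ≤ M →
      (126 * √(K + 3) + 4 * √(Real.log 6 + (K + 2) * Real.log 27)) * √M +
        Real.log 192 ≤ κ * M →
      ((K + 2) * M + 1) ^ 63 * 192 * Real.exp (4 * √(Real.log 6 + (K + 2) * M * Real.log 27)) ≤
        Real.exp (κ * M) := by
    intro K M κ hK hM hbound
    have h6 : 0 ≤ Real.log 6 := Real.log_nonneg (by norm_num)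
    have h27 : 0 ≤ Real.log 27 := Real.log_nonneg (by norm_num)
    have hX : 0 ≤ Real.log 6 + (K + 2) * Real.log 27 := add_nonneg h6 (by positivity)
    have hM0 : 0 ≤ M := zero_le_one.trans hM
    have hN0 : 0 < (K + 2) * M + 1 := by positivity
    have hN1 : (K + 2) * M + 1 ≤ (K + 3) * M := by nlinarith
    have hlog : Real.log ((K + 2) * M + 1) ≤ 2 * √((K + 2) * M + 1) := log_le_two_mul_sqrt hN0
    have hs1 : √((K + 2) * M + 1) ≤ √(K + 3) * √M := by
      rw [← Real.sqrt_mul (by positivity)]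
      exact Real.sqrt_le_sqrt hN1
    have hin : Real.log 6 + (K + 2) * M * Real.log 27 ≤ (Real.log 6 + (K + 2) * Real.log 27) * M := by
      nlinarith
    have hs2 : √(Real.log 6 + (K + 2) * M * Real.log 27) ≤
        √(Real.log 6 + (K + 2) * Real.log 27) * √M := by
      rw [← Real.sqrt_mul hX]
      exact Real.sqrt_le_sqrt hin
    rw [← Real.log_le_iff_le_exp (by positivity), Real.log_mul (by positivity) (by positivity),
      Real.log_mul (by positivity) (by positivity), Real.log_pow, Real.log_exp]
    push_cast
    linarith [hlog, hs1, hs2, hbound]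
  have hq1 : (1 : ℝ) < q := by exact_mod_cast (lt_of_lt_of_le one_lt_two hq)
  have hq0 : (0 : ℝ) < q := zero_lt_one.trans hq1
  have hL : 0 < Real.log (q : ℝ) := Real.log_pos hq1
  have hm1 : (1 : ℝ) ≤ m := by exact_mod_cast hm
  have hm0 : (0 : ℝ) < m := by linarith
  have hN₀2 : (2 : ℝ) ≤ N₀ := by exact_mod_cast hN₀
  have hN₀0 : (0 : ℝ) < N₀ := by linarith
  have hK : (0 : ℝ) ≤ (N₀ : ℝ) - 2 := by linarith
  obtain ⟨L₀, hL₀⟩ := exists_nat_forall_sqrt_le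
    (126 * √((N₀ : ℝ) - 2 + 3) + 4 * √(Real.log 6 + ((N₀ : ℝ) - 2 + 2) * Real.log 27)) (Real.log 192)
    (δ * m * Real.log (q : ℝ)) (by positivity)
  obtain ⟨L, hL1, hLL⟩ : ∃ L : ℕ, 1 ≤ L ∧
      (126 * √((N₀ : ℝ) - 2 + 3) + 4 * √(Real.log 6 + ((N₀ : ℝ) - 2 + 2) * Real.log 27)) * √(L : ℝ) +
        Real.log 192 ≤ δ * m * Real.log (q : ℝ) * L :=
    ⟨max L₀ 1, le_max_right _ _, hL₀ _ (le_max_left _ _)⟩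
  refine ⟨L, hL1, fun V hV => ?_⟩
  have hM1 : (1 : ℝ) ≤ L := by exact_mod_cast hL1
  have hN : (((L * N₀ : ℕ) : ℝ)) = ((N₀ : ℝ) - 2 + 2) * L := by push_cast; ring
  rw [hN] at hV
  have hloss := lossGen hK hM1 hLL
  have hmain : Real.exp (((N₀ : ℝ) - 2 + 2) * L * H) ≤
      (V : ℝ) * Real.exp (δ * m * Real.log (q : ℝ) * L) :=
    calc Real.exp (((N₀ : ℝ) - 2 + 2) * L * H)
        ≤ (V : ℝ) * (((N₀ : ℝ) - 2 + 2) * L + 1) ^ 63 * 192 *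
            Real.exp (4 * √(Real.log 6 + ((N₀ : ℝ) - 2 + 2) * L * Real.log 27)) := hV
      _ = (V : ℝ) * ((((N₀ : ℝ) - 2 + 2) * L + 1) ^ 63 * 192 *
            Real.exp (4 * √(Real.log 6 + ((N₀ : ℝ) - 2 + 2) * L * Real.log 27))) := by
          rw [mul_assoc (V : ℝ), mul_assoc (V : ℝ)]
      _ ≤ (V : ℝ) * Real.exp (δ * m * Real.log (q : ℝ) * L) :=
          mul_le_mul_of_nonneg_left hloss (Nat.cast_nonneg V)
  have hkey : 1 ≤ (V : ℝ) *
      Real.exp (δ * m * Real.log (q : ℝ) * L - ((N₀ : ℝ) - 2 + 2) * L * H) := by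
    rw [Real.exp_sub, mul_div_assoc', one_le_div (Real.exp_pos _)]
    exact hmain
  have hqm : (0 : ℝ) < (q : ℝ) ^ (L * m) := pow_pos hq0 _
  have hcast : ((q ^ (L * m) : ℕ) : ℝ) = (q : ℝ) ^ (L * m) := by push_cast; rfl
  have hA : Real.exp (((N₀ : ℝ) - 2 + 2) * L * Real.log R) = R ^ (L * N₀) := by
    rw [← Real.exp_log (pow_pos hR (L * N₀)), Real.log_pow]
    congr 1
    push_cast
    ring
  have halg : Real.log ((q : ℝ) ^ (L * m)) *
      ((Real.log R - H) / ((m : ℝ) / (N₀ : ℝ) * Real.log (q : ℝ)) + δ) =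
      ((N₀ : ℝ) - 2 + 2) * L * Real.log R +
        (δ * m * Real.log (q : ℝ) * L - ((N₀ : ℝ) - 2 + 2) * L * H) := by
    rw [Real.log_pow]
    push_cast
    field_simp
    ring
  rw [hcast, Real.rpow_def_of_pos hqm, halg, Real.exp_add, hA]
  have hP : 0 ≤ R ^ (L * N₀) := by positivity
  calc R ^ (L * N₀) = 1 * R ^ (L * N₀) := (one_mul _).symm
    _ ≤ ((V : ℝ) * Real.exp (δ * m * Real.log (q : ℝ) * L - ((N₀ : ℝ) - 2 + 2) * L * H)) *
          R ^ (L * N₀) := mul_le_mul_of_nonneg_right hkey hP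
    _ = (V : ℝ) * (R ^ (L * N₀) *
          Real.exp (δ * m * Real.log (q : ℝ) * L - ((N₀ : ℝ) - 2 + 2) * L * H)) := by ring

end LayerC

end Summit.MatrixMultiplication.MatrixMultiplication.Theorems.LittleCwFarEdgeBound
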